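import Literature.AlgebraicGeometry.Resolution.BlowupChartRegular
import Literature.AlgebraicGeometry.Resolution.RegularLocalRingsJacobian
import Mathlib.RingTheory.RegularLocalRing.Polynomial
import Summits.ResolutionOfSingularities.ResolutionOfSingularities.Theorems.WeightedInvariantHypersurfaceLocalGameEFTPointMoveChart
import HarnessLib

/-!
# The e.f.t. local weighted game (H2a′), point moves II: the successor local rings `B_𝔫` on the exceptional divisor

Topic: `Summits/ResolutionOfSingularities/ResolutionOfSingularities/Theorems`. Helper for the door item
`HypersurfaceCentreConstruction` (statement `stmt-ResolutionOfSingularities-19897`, route `WeightedInvariant`);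
kernel K3b-i of the dim-2 design memo `L/res-type-098-w43/EFT-DIM2-DESIGN.md` v2 (ORDER (o13) of `res-L1-w43-plan-1`).

[OURS · L1 W4.3] Replaces the role of NO printed item; NOT a statement of the manuscript
[claim: Hironaka2017, status: under-review]. AI work, weaker than expert review.

## Content

Setting of `…EFTPointMoveChart` (`S` regular local, `u` a regular system of parameters, weights all positive,
`B = S[t⁻¹, 𝒥ₙtⁿ]`, `rho : B → κ[X]` the exceptional chart), and a prime `𝔫 ∋ t⁻¹` of `B`:

* `isRegularRing_quotient_span_tInv` — `B/(t⁻¹) ≅ κ[X₁,…,X_d]` is a regular ring;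
* `psi`, `isLocalization_quotient_span_tInv` — for every localisation `L` of `B` at `𝔫` (abstract
  `[IsLocalization.AtPrime L 𝔫]`: quotients of `Localization.AtPrime` of a subalgebra type hit an instance diamond),
  `L/(t⁻¹)L` is the localisation of `κ[X]` at `rho(𝔫)` through `psi : κ[X] ≅ B/(t⁻¹) → L/(t⁻¹)L`;
* `isRegularLocalRing_quotient_span_tInv` — hence `L/(t⁻¹)L` is a regular local ring;
* **`isRegularLocalRing_of_isLocalization`** — `L ≅ B_𝔫` is a regular local ring (Włodarczyk §2.3.9: `B` is regular);
* **`adicOrder_tInv_eq_one`** — `ord_L(t⁻¹) = 1`: the exceptional equation is a regular parameter of every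
  local ring of `B` on the exceptional divisor (Matsumura 14.2 via the tree's
  `not_isRegularLocalRing_quotient_span_singleton_of_mem_sq`).

These are the structural inputs of the case-C («sub-integral slope») count of the dim-2 rung (memo v2 §B, K3b-iii).

## References

* J. Włodarczyk, *Functorial resolution by torus actions*, arXiv:2203.03090, §2.3.9. [Wlodarczyk2022]
* H. Matsumura, *Commutative Ring Theory*, Thm. 14.2. [Matsumura1987]
-/

noncomputable section

open IsLocalRing Literature.AlgebraicGeometry.Resolution
open LaurentPolynomial
open scoped LaurentPolynomial

set_option linter.dupNamespace false -- mandated namespace of this single-conjunct summit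

namespace Summit.ResolutionOfSingularities.ResolutionOfSingularities.Theorems

namespace LocalGameEFTPointMove

variable {S : Type} [CommRing S] {d : ℕ} (u : Fin d → S) (w : Fin d → ℕ)

/-- `S/(u) = S/𝔪` is a field, hence a regular ring. [folklore] -/
theorem isRegularRing_quotient_span_range [IsLocalRing S] (hu : Ideal.span (Set.range u) = maximalIdeal S) :
    IsRegularRing (S ⧸ Ideal.span (Set.range u)) := by
  haveI : (Ideal.span (Set.range u)).IsMaximal := by rw [hu]; exact IsLocalRing.maximalIdeal.isMaximal S
  letI : Field (S ⧸ Ideal.span (Set.range u)) := Ideal.Quotient.field _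
  infer_instance

variable [IsRegularLocalRing S] (hu : Ideal.span (Set.range u) = maximalIdeal S)
  (hd : (maximalIdeal S).spanFinrank = d) (hw : ∀ i, 0 < w i)

include hu hd hw in
/-- `B/(t⁻¹) ≅ κ[X₁,…,X_d]` is a regular ring. [cite: Wlodarczyk2022, §2.3.9] -/
theorem isRegularRing_quotient_span_tInv :
    IsRegularRing (↥(extReesAlgebra (weightedMonomialIdeal u w)) ⧸
      Ideal.span {extReesAlgebra.tInv (weightedMonomialIdeal u w)}) := by
  haveI := isRegularRing_quotient_span_range u hu
  exact IsRegularRing.of_ringEquiv (quotEquiv u w hu hd hw).symm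

variable (𝔫 : Ideal (extReesAlgebra (weightedMonomialIdeal u w)))
  (hT : extReesAlgebra.tInv (weightedMonomialIdeal u w) ∈ 𝔫)

variable [𝔫.IsPrime]

variable (L : Type) [CommRing L] [Algebra (extReesAlgebra (weightedMonomialIdeal u w)) L]
  [IsLocalization.AtPrime L 𝔫]

include hu hd hw hT in
/-- **`B_𝔫` is a regular local ring** for every prime `𝔫 ∋ t⁻¹` and every localisation `L` of `B` at `𝔫`
(`t⁻¹` a non-zero-divisor with regular quotient; tree `isRegularLocalRing_localization_of_mem_of_quotient`).
[cite: Wlodarczyk2022, §2.3.9] -/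
theorem isRegularLocalRing_of_isLocalization : IsRegularLocalRing L := by
  have hreg := isRegularRing_quotient_span_tInv u w hu hd hw
  have hN : IsNoetherianRing ↥(extReesAlgebra (weightedMonomialIdeal u w)) :=
    isNoetherianRing_extReesAlgebra (stub_extReesAlgebra_weighted u w)
  have h := @isRegularLocalRing_localization_of_mem_of_quotient _ _ hN _ (tInv_mem_nonZeroDivisors _) hreg 𝔫 _ hT
  exact @IsRegularLocalRing.of_ringEquiv _ _ h _ _
    (IsLocalization.algEquiv 𝔫.primeCompl (Localization.AtPrime 𝔫) L).toRingEquiv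

/-- The `κ[X]`-algebra map `κ[X] ≅ B/(t⁻¹) → L/(t⁻¹)L` induced by `B → L`. [folklore] -/
def psi : MvPolynomial (Fin d) (S ⧸ Ideal.span (Set.range u)) →+*
    L ⧸ Ideal.span {algebraMap (extReesAlgebra (weightedMonomialIdeal u w)) L
      (extReesAlgebra.tInv (weightedMonomialIdeal u w))} :=
  (Ideal.Quotient.lift (Ideal.span {extReesAlgebra.tInv (weightedMonomialIdeal u w)})
    ((Ideal.Quotient.mk _).comp (algebraMap (extReesAlgebra (weightedMonomialIdeal u w)) L))
    (fun a ha => by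
      obtain ⟨c, rfl⟩ := Ideal.mem_span_singleton'.mp ha
      rw [RingHom.comp_apply, map_mul, Ideal.Quotient.eq_zero_iff_mem]
      exact Ideal.mul_mem_left _ _ (Ideal.mem_span_singleton_self _))).comp
    (quotEquiv u w hu hd hw).symm.toRingHom

/-- `psi ∘ rho = mk ∘ algebraMap`. [folklore] -/
theorem psi_rho (b : extReesAlgebra (weightedMonomialIdeal u w)) :
    psi u w hu hd hw L (rho u w hu hd hw b) =
      Ideal.Quotient.mk _ (algebraMap (extReesAlgebra (weightedMonomialIdeal u w)) L b) := by
  rw [psi, rho, RingHom.comp_apply, RingHom.comp_apply, RingEquiv.toRingHom_eq_coe, RingEquiv.toRingHom_eq_coe,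
    RingHom.coe_coe, RingHom.coe_coe, RingEquiv.symm_apply_apply, Ideal.Quotient.lift_mk, RingHom.comp_apply]

/-- **Localisation commutes with the quotient by `t⁻¹`, read in the exceptional chart**: for a prime `𝔫'` of `κ[X]`
with `rho⁻¹(𝔫') = 𝔫`, `L/(t⁻¹)L` is (via `psi`) the localisation of `κ[X]` at `𝔫'`. [folklore] -/
theorem isLocalization_quotient_span_tInv (𝔫' : Ideal (MvPolynomial (Fin d) (S ⧸ Ideal.span (Set.range u))))
    [𝔫'.IsPrime] (h𝔫' : 𝔫 = 𝔫'.comap (rho u w hu hd hw)) :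
    @IsLocalization.AtPrime (MvPolynomial (Fin d) (S ⧸ Ideal.span (Set.range u))) _
      (L ⧸ Ideal.span {algebraMap (extReesAlgebra (weightedMonomialIdeal u w)) L
        (extReesAlgebra.tInv (weightedMonomialIdeal u w))}) _ (psi u w hu hd hw L).toAlgebra 𝔫' _ := by
  letI := (psi u w hu hd hw L).toAlgebra
  have hM : 𝔫.primeCompl.map (rho u w hu hd hw) = 𝔫'.primeCompl := by
    ext x
    constructor
    · rintro ⟨b, hb, rfl⟩
      intro hx
      exact hb (h𝔫' ▸ Ideal.mem_comap.mpr hx)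
    · intro hx
      obtain ⟨b, rfl⟩ := rho_surjective u w hu hd hw x
      exact ⟨b, fun hb => hx (Ideal.mem_comap.mp (h𝔫' ▸ hb)), rfl⟩
  have key := IsLocalization.of_surjective 𝔫.primeCompl L (rho u w hu hd hw) (rho_surjective u w hu hd hw)
    (Ideal.Quotient.mk (Ideal.span {algebraMap (extReesAlgebra (weightedMonomialIdeal u w)) L
      (extReesAlgebra.tInv (weightedMonomialIdeal u w))})) Ideal.Quotient.mk_surjective
    (RingHom.ext fun b => by
      rw [RingHom.comp_apply, RingHom.comp_apply, RingHom.algebraMap_toAlgebra]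
      exact (psi_rho u w hu hd hw L b).symm)
    (by
      rw [Ideal.mk_ker, ker_rho, Ideal.map_span, Set.image_singleton])
  rwa [hM] at key

include hu hd hw hT in
/-- **`B_𝔫/(t⁻¹)` is a regular local ring** (a localisation of the regular ring `κ[X]`).
[cite: Wlodarczyk2022, §2.3.9] -/
theorem isRegularLocalRing_quotient_span_tInv :
    IsRegularLocalRing (L ⧸ Ideal.span {algebraMap (extReesAlgebra (weightedMonomialIdeal u w)) L
      (extReesAlgebra.tInv (weightedMonomialIdeal u w))}) := by
  haveI := nbar_isPrime u w hu hd hw 𝔫 hT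
  letI := (psi u w hu hd hw L).toAlgebra
  haveI := isLocalization_quotient_span_tInv u w hu hd hw 𝔫 L (nbar u w hu hd hw 𝔫)
    (comap_rho_nbar u w hu hd hw 𝔫 hT).symm
  have hregQ := isRegularRing_quotient_span_range u hu
  have hregX : IsRegularRing (MvPolynomial (Fin d) (S ⧸ Ideal.span (Set.range u))) :=
    @MvPolynomial.isRegularRing_of_isRegularRing _ _ hregQ _ _
  have h1 : IsRegularLocalRing (Localization.AtPrime (nbar u w hu hd hw 𝔫)) :=
    @IsRegularRing.isRegularLocalRing_localization _ _ hregX _ _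
  have e := (IsLocalization.algEquiv (nbar u w hu hd hw 𝔫).primeCompl
    (L ⧸ Ideal.span {algebraMap (extReesAlgebra (weightedMonomialIdeal u w)) L
      (extReesAlgebra.tInv (weightedMonomialIdeal u w))})
    (Localization.AtPrime (nbar u w hu hd hw 𝔫))).toRingEquiv
  exact @IsRegularLocalRing.of_ringEquiv _ _ h1 _ _ e.symm

include hu hd hw hT in
/-- **The exceptional equation is a regular parameter**: `ord_L(t⁻¹) = 1` in every localisation `L` of `B` at a
prime `𝔫 ∋ t⁻¹`. [cite: Matsumura1987, Thm. 14.2] -/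
theorem adicOrder_tInv_eq_one [IsLocalRing L] :
    adicOrder (algebraMap (extReesAlgebra (weightedMonomialIdeal u w)) L
      (extReesAlgebra.tInv (weightedMonomialIdeal u w))) = 1 := by
  haveI := isRegularLocalRing_of_isLocalization u w hu hd hw 𝔫 hT L
  set t := algebraMap (extReesAlgebra (weightedMonomialIdeal u w)) L
    (extReesAlgebra.tInv (weightedMonomialIdeal u w)) with htdef
  have ht0 : t ≠ 0 :=
    nonZeroDivisors.ne_zero (IsLocalization.nonZeroDivisors_le_comap 𝔫.primeCompl L (tInv_mem_nonZeroDivisors _))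
  have htm : t ∈ maximalIdeal L := by
    rw [htdef, ← IsLocalization.AtPrime.map_eq_maximalIdeal 𝔫 L]
    exact Ideal.mem_map_of_mem _ hT
  have ht2 : t ∉ (maximalIdeal L) ^ 2 := fun h =>
    not_isRegularLocalRing_quotient_span_singleton_of_mem_sq ht0 h
      (isRegularLocalRing_quotient_span_tInv u w hu hd hw 𝔫 hT L)
  refine le_antisymm ?_ ?_
  · exact (adicOrder_le_iff t 1).mpr (by simpa [one_add_one_eq_two] using ht2)
  · exact_mod_cast (le_adicOrder_iff t 1).mpr (by rwa [pow_one])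

end LocalGameEFTPointMove

end Summit.ResolutionOfSingularities.ResolutionOfSingularities.Theorems

end
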